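import Literature.NumberTheory.EllipticCurves.HeegnerPointsKolyvaginPrimaryClassesProofs
import Literature.NumberTheory.EllipticCurves.VariableChangePointsMap
import Literature.NumberTheory.EllipticCurves.HuShuYin2019.SylvesterThreePart
import HarnessLib

/-!
# Cubic twists of `j = 0` curves: the transport `E_b(k̄) ≃ E_{c²b}(k̄)`, its Galois twist law, and
# the dictionary for Kolyvagin's classes (Hu–Shu–Yin's CM frame at `p = 2`)

For two `j = 0` short Weierstrass models `E : y² = x³ + b` and `E' : y² = x³ + c² b` over a field
`k` (all of `a₁, …, a₄` zero) and a cube root `v ∈ k̄` of `c ∈ kˣ`, the substitution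
`(x, y) ↦ (v² x, v³ y)` is an isomorphism `ψ : E(k̄) ≃+ E'(k̄)` defined over `k(v)` — Hu–Shu–Yin's
`E_1 → E_p, (x, y) ↦ ((∛p)² x, p y)` "defined over `L_{(p)} = K(∛p)`" and `φ : E_9 → E_1`
(Hu–Shu–Yin 2019, §2, p. 8), and in general the isomorphism `E_a ≅ E_{ac}` of cube-sum curves over
`k(∛c)` (Silverman, *AEC*, X.5.4: the twists of a `j = 0` curve by `k(∛c)`). It is NOT
`Γ_k`-equivariant: for `g ∈ Γ_k = Gal(k̄/k)` one has the **twist law**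
`g (ψ P) = ψ (ρ_g (g P))` with `ρ_g = [ζ_g²]`, `ζ_g := g(v)/v ∈ μ₃`, `[ζ] (x, y) := (ζ x, y)` the
CM automorphism (Hu–Shu–Yin's normalisation `[ω](x, y) = (ω x, y)`, p. 4), i.e. `ψ` intertwines the
`χ`-twisted Galois action on `E` for the cubic character `χ(g) = (∛c)^{g-1}` (Hu–Shu–Yin's
`χ(σ) = (∛(3p))^{σ-1}`, p. 4) with the ordinary action on `E'`. Consequences typed here, for the
`p = 2` Kolyvagin argument in the CM frame (route K7t, crux `UpperOffV0HSYPlus`, VARIANT K; cell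
memo "two" §57.3: *"over `H_{9pn} ⊃ L` the twist `E_9 ≅ E_9^χ` identifies `(E_9(H_{9pn})/2^M)^{(Gal,χ)}`
with `(E_9^χ(H_{9pn})/2^M)^{Gal}`"*, the analogue of Gross 1991 (4.2)–(4.4)):

* `JZero.exists_scaling_addEquiv` — over any field: `(x, y) ↦ (w² x, w³ y)` is an additive
  isomorphism `V(F) ≃+ V'(F)` when `a₆' = w⁶ a₆` (Silverman III.3.1(b); built from the tree's
  `VariableChange.pointEquiv` of `C = (w⁻¹, 0, 0, 0)` and `Affine.Point.congrEquiv`);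
* `JZero.exists_mulX_addEquiv` — the CM automorphisms `[ζ] : (x, y) ↦ (ζ x, y)`, `ζ³ = 1`, of
  `E(k̄)` (no ellipticity hypothesis; cf. the tree's `JZero.exists_cm_addEquiv`);
* `JZero.exists_cubicTwist_transport` — `ψ` and the family `ρ : Γ_k → Aut E(k̄)` with their
  coordinate descriptions and the twist law `g • ψ P = ψ (ρ g (g • P))`; the API is stated on the
  coordinate descriptions (`…_of_apply_eq`), so that it applies to any `ψ`, `ρ` so obtained:
  `JZero.smul_cubicTwist_of_apply_eq` (twist law), `JZero.cubicTwist_smul_of_fix` (equivariance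
  under `Gal(k̄/k(v))`), `JZero.smul_rho_of_apply_eq` (the `ρ_g` are `Γ_k`-equivariant when
  `μ₃ ⊂ k`, `JZero.apply_eq_self_of_pow_three_eq_one`), fixed points under a subgroup fixing `v`
  correspond (`JZero.forall_smul_cubicTwist_eq_iff`);
* the KOLYVAGIN DICTIONARY for the tree's classes `kolyvaginClass W' n hdiv hA P hP ∈ H¹(k, E'[n])`
  (`HeegnerPointsKolyvaginPrimaryClassesProofs`): admissibility and `τ`-freeness move along `ψ`
  (`JZero.isAdmissible_map_cubicTwist`), `ψ Q ∈ invPoints ↔ ρ_g(gQ) − Q ∈ nA ∀ g`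
  (`JZero.cubicTwist_mem_invPoints_iff` — the `χ`-isotypic condition *"`hQ ≡ [χ(h)] Q`"* of
  Gross 1991 §12 / memo §57.3), Gross's Prop. 4.7 (1)/(2) in the twisted frame
  (`JZero.kolyvaginClass_cubicTwist_eq_zero_iff`: `c(ψQ) = 0 ↔ Q ∈ nA`;
  `JZero.torsionH1ToH1_kolyvaginClass_cubicTwist_eq_zero_iff`: `d(ψQ) = 0 ↔ Q ∈ nA + E^χ(k)`), and
  the rationality dictionary `ψ Q ∈ E'(k) ↔ ρ_g (g Q) = Q ∀ g` (`JZero.exists_toGeomPoints_eq_cubicTwist_iff`;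
  Hu–Shu–Yin: *"`E_1(L_{(p)})^{σ_{ω₃} = ω^α}` is identified with `E_p(K)`"*, p. 8);
* the same law for a lift `τ` of an automorphism of `K/k₀` acting on `E(K̄)` through the tree's
  `IsLiftOfAut.pointsMap` (`JZero.IsLiftOfAut.pointsMap_cubicTwist_of_apply_eq`; Gross 1991 Prop. 5.4
  needs `τ y_n`);
* the instantiation on Hu–Shu–Yin's cube-sum models `cubeSumCurve a = ⟨0,0,0,0,−432a²⟩`:
  `HuShuYin2019.exists_cubicTwist_transport_cubeSumCurve` (`E_a ≅ E_{ac}` over `K(∛c)`, any number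
  field / characteristic-zero field `K`; `(a, c) = (9, p/9)`: `E_9 ≅ E_p`; `(9, p²/3)`: `E_9 ≅ E_{3p²}`;
  `(1, p)`: Hu–Shu–Yin's `E_1 ≅ E_p`).

Everything is proved; no definition, no named fact, no `sorry`. Nothing here is specific to a
prime `p` or asserts anything about a Selmer group; BSD is not claimed.

## References

* [HuShuYin2019] Y. Hu, J. Shu, H. Yin, *An explicit Gross–Zagier formula related to the Sylvester
  conjecture*, Trans. AMS 372 (2019) (arXiv:1708.05266): §1 p. 4 (`y² = x³ − 432n²`, `[ω](x,y) =
  (ωx, y)`, `χ(σ) = (∛(3p))^{σ−1}`), §2 p. 8 (`φ : E_9 → E_1`; `E_1(L_{(p)})^{σ=ω^α} ≅ E_p(K)` via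
  `(x, y) ↦ ((∛p)²x, py)`). Held: `paper:arxiv-1708.05266` pp. 4, 8.
* [SilvermanAEC2009] J. H. Silverman, *The Arithmetic of Elliptic Curves*, 2nd ed., GTM 106:
  III.1 Table 3.1, III.3.1(b), III.10.1 (`Aut E = μ₆` for `j = 0`), X.2.2 and X.5.4 (twists).
* [GrossLMS1991] B. H. Gross, *Kolyvagin's work on modular elliptic curves*, LMS LN 153 (1991):
  §4 (4.2)–(4.4), Prop. 4.7; §12 p. 232 (the `χ`-components `y_χ`).
-/

noncomputable section

open scoped Classical
open WeierstrassCurve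

universe u v

namespace Literature.NumberTheory.EllipticCurves

namespace JZero

/-! ## §1 Scalings `(x, y) ↦ (w² x, w³ y)` between `j = 0` short models over a field -/

section Scaling

variable {F : Type u} [Field F] (V V' : WeierstrassCurve F)

/-- **The scaling isomorphism.** For short `j = 0` models `V : y² = x³ + a₆`, `V' : y² = x³ + a₆'`
over a field `F` (all of `a₁, …, a₄` zero) with `a₆' = w⁶ a₆`, `w ∈ Fˣ`, the substitution
`(x, y) ↦ (w² x, w³ y)` is an isomorphism of the groups of `F`-points: it is the tree's
`VariableChange.pointEquiv` for `C = (u, r, s, t) = (w⁻¹, 0, 0, 0)` (`x' = u⁻²x`, `y' = u⁻³y`)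
followed by the transport along `C • V = V'`. Silverman, *AEC*, III.1 Table 3.1 and III.3.1(b).
[cite: SilvermanAEC2009, III.3.1(b)] -/
theorem exists_scaling_addEquiv (h₁ : V.a₁ = 0) (h₂ : V.a₂ = 0) (h₃ : V.a₃ = 0) (h₄ : V.a₄ = 0)
    (h₁' : V'.a₁ = 0) (h₂' : V'.a₂ = 0) (h₃' : V'.a₃ = 0) (h₄' : V'.a₄ = 0) {w : F} (hw : w ≠ 0)
    (h₆ : V'.a₆ = w ^ 6 * V.a₆) :
    ∃ ψ : V.toAffine.Point ≃+ V'.toAffine.Point,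
      ∀ {x y : F} (h : V.toAffine.Nonsingular x y),
        ∃ h', ψ (.some x y h) = .some (w ^ 2 * x) (w ^ 3 * y) h' := by
  let u : Fˣ := Units.mk0 w hw
  let C : VariableChange F := ⟨u⁻¹, 0, 0, 0⟩
  have hCu : ((C.u⁻¹ : Fˣ) : F) = w := by
    change (((Units.mk0 w hw)⁻¹)⁻¹ : Fˣ) = (w : F)
    rw [inv_inv, Units.val_mk0]
  have hC : C • V = V' := by
    ext
    · rw [variableChange_a₁, h₁, h₁']; simp [C]
    · rw [variableChange_a₂, h₁, h₂, h₂']; simp [C]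
    · rw [variableChange_a₃, h₁, h₃, h₃']; simp [C]
    · rw [variableChange_a₄, h₁, h₂, h₃, h₄, h₄']; simp [C]
    · rw [variableChange_a₆, hCu, h₁, h₂, h₃, h₄, h₆]; simp [C]
  refine ⟨(VariableChange.pointEquiv V C).trans (Affine.Point.congrEquiv hC), fun {x y} h ↦ ?_⟩
  have hx : C.toX x = w ^ 2 * x := by rw [VariableChange.toX_def, hCu]; simp [C]
  have hy : C.toY x y = w ^ 3 * y := by rw [VariableChange.toY_def, hCu]; simp [C]
  have h' : V'.toAffine.Nonsingular (w ^ 2 * x) (w ^ 3 * y) := by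
    have := (VariableChange.nonsingular_iff V C x y).mpr h
    rw [hx, hy, hC] at this
    exact this
  refine ⟨h', ?_⟩
  rw [AddEquiv.trans_apply, VariableChange.pointEquiv_some, Affine.Point.congrEquiv_some]
  exact Affine.Point.some_eq_some_of_eq hx hy

end Scaling

/-! ## §2 The transport `ψ : E(k̄) ≃+ E'(k̄)` and the CM automorphisms `[ζ]` -/

section Transport

variable {k : Type u} [Field k] (W W' : WeierstrassCurve k)

/-- The `Γ_k`-action on an affine geometric point is coordinatewise (definitionally). Silverman,
*AEC*, VIII.§1. [folklore] -/
private theorem smul_some_eq (g : Field.absoluteGaloisGroup k) {x y : AlgebraicClosure k}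
    (h : (W.baseChange (AlgebraicClosure k)).toAffine.Nonsingular x y) :
    ∃ h', @HSMul.hSMul (Field.absoluteGaloisGroup k) (geomPoints W) (geomPoints W) instHSMul g
        (Affine.Point.some x y h) =
      Affine.Point.some ((show AlgebraicClosure k ≃ₐ[k] AlgebraicClosure k from g) x)
        ((show AlgebraicClosure k ≃ₐ[k] AlgebraicClosure k from g) y) h' :=
  ⟨_, rfl⟩

/-- The coefficients of `V⁄k̄` are the images of those of `V` (definitionally). [folklore] -/
private theorem baseChange_a (V : WeierstrassCurve k) :
    (V.baseChange (AlgebraicClosure k)).a₁ = algebraMap k _ V.a₁ ∧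
    (V.baseChange (AlgebraicClosure k)).a₂ = algebraMap k _ V.a₂ ∧
    (V.baseChange (AlgebraicClosure k)).a₃ = algebraMap k _ V.a₃ ∧
    (V.baseChange (AlgebraicClosure k)).a₄ = algebraMap k _ V.a₄ ∧
    (V.baseChange (AlgebraicClosure k)).a₆ = algebraMap k _ V.a₆ :=
  ⟨rfl, rfl, rfl, rfl, rfl⟩

/-- **The cubic-twist transport `ψ`.** For `j = 0` short models `E = W : y² = x³ + b`,
`E' = W' : y² = x³ + c²b` over `k` and `v ∈ k̄` with `v³ = c ≠ 0`, there is an additive isomorphism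
`ψ : E(k̄) ≃+ E'(k̄)` acting on affine points by `(x, y) ↦ (v² x, v³ y)` — Hu–Shu–Yin's
`(x, y) ↦ ((∛p)² x, p y) : E_1 → E_p` (`v = ∛p`). [cite: HuShuYin2019, §2 p. 8]
[cite: SilvermanAEC2009, III.3.1(b), X.5.4] -/
theorem exists_cubicTwist_addEquiv (ha₁ : W.a₁ = 0) (ha₂ : W.a₂ = 0) (ha₃ : W.a₃ = 0)
    (ha₄ : W.a₄ = 0) (ha₁' : W'.a₁ = 0) (ha₂' : W'.a₂ = 0) (ha₃' : W'.a₃ = 0) (ha₄' : W'.a₄ = 0)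
    {c : k} (hc : c ≠ 0) (hW' : W'.a₆ = c ^ 2 * W.a₆) {v : AlgebraicClosure k}
    (hvc : v ^ 3 = algebraMap k (AlgebraicClosure k) c) :
    ∃ ψ : geomPoints W ≃+ geomPoints W',
      ∀ {x y : AlgebraicClosure k} (h : (W.baseChange (AlgebraicClosure k)).toAffine.Nonsingular x y),
        ∃ h', ψ (Affine.Point.some x y h) = Affine.Point.some (v ^ 2 * x) (v ^ 3 * y) h' := by
  have hv : v ≠ 0 := by
    rintro rfl
    rw [zero_pow three_ne_zero, eq_comm, map_eq_zero] at hvc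
    exact hc hvc
  obtain ⟨e₁, e₂, e₃, e₄, e₆⟩ := baseChange_a (k := k) W
  obtain ⟨e₁', e₂', e₃', e₄', e₆'⟩ := baseChange_a (k := k) W'
  have h₆ : (W'.baseChange (AlgebraicClosure k)).a₆ = v ^ 6 * (W.baseChange (AlgebraicClosure k)).a₆ := by
    rw [e₆, e₆', hW', map_mul, map_pow, ← hvc]; ring
  exact exists_scaling_addEquiv (W.baseChange (AlgebraicClosure k)) (W'.baseChange (AlgebraicClosure k))
    (by rw [e₁, ha₁, map_zero]) (by rw [e₂, ha₂, map_zero]) (by rw [e₃, ha₃, map_zero])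
    (by rw [e₄, ha₄, map_zero]) (by rw [e₁', ha₁', map_zero]) (by rw [e₂', ha₂', map_zero])
    (by rw [e₃', ha₃', map_zero]) (by rw [e₄', ha₄', map_zero]) hv h₆

/-- **The CM automorphisms `[ζ] : (x, y) ↦ (ζ x, y)`** of `E(k̄)` for a `j = 0` short model and
`ζ³ = 1` (Hu–Shu–Yin's normalisation `[ω](x, y) = (ω x, y)`; the scaling by `w = ζ²`:
`w² = ζ`, `w³ = 1`). No ellipticity hypothesis (cf. the tree's `JZero.exists_cm_addEquiv`).
[cite: HuShuYin2019, §1 p. 4] [cite: SilvermanAEC2009, Thm. III.10.1] -/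
theorem exists_mulX_addEquiv (ha₁ : W.a₁ = 0) (ha₂ : W.a₂ = 0) (ha₃ : W.a₃ = 0) (ha₄ : W.a₄ = 0)
    {ζ : AlgebraicClosure k} (hζ : ζ ^ 3 = 1) :
    ∃ ω₁ : geomPoints W ≃+ geomPoints W,
      ∀ {x y : AlgebraicClosure k} (h : (W.baseChange (AlgebraicClosure k)).toAffine.Nonsingular x y),
        ∃ h', ω₁ (Affine.Point.some x y h) = Affine.Point.some (ζ * x) y h' := by
  obtain ⟨e₁, e₂, e₃, e₄, -⟩ := baseChange_a (k := k) W
  have hζ0 : ζ ≠ 0 := by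
    rintro rfl
    norm_num at hζ
  have hw : ζ ^ 2 ≠ 0 := pow_ne_zero 2 hζ0
  have h₆ : (W.baseChange (AlgebraicClosure k)).a₆ =
      (ζ ^ 2) ^ 6 * (W.baseChange (AlgebraicClosure k)).a₆ := by
    have : (ζ ^ 2) ^ 6 = 1 := by
      calc (ζ ^ 2) ^ 6 = (ζ ^ 3) ^ 4 := by ring
        _ = 1 := by rw [hζ, one_pow]
    rw [this, one_mul]
  obtain ⟨ω₁, hω₁⟩ := exists_scaling_addEquiv (W.baseChange (AlgebraicClosure k))
    (W.baseChange (AlgebraicClosure k))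
    (by rw [e₁, ha₁, map_zero]) (by rw [e₂, ha₂, map_zero]) (by rw [e₃, ha₃, map_zero])
    (by rw [e₄, ha₄, map_zero]) (by rw [e₁, ha₁, map_zero]) (by rw [e₂, ha₂, map_zero])
    (by rw [e₃, ha₃, map_zero]) (by rw [e₄, ha₄, map_zero]) hw h₆
  refine ⟨ω₁, fun {x y} h ↦ ?_⟩
  obtain ⟨h', e⟩ := hω₁ h
  have hx : (ζ ^ 2) ^ 2 * x = ζ * x := by
    calc (ζ ^ 2) ^ 2 * x = ζ ^ 3 * ζ * x := by ring
      _ = ζ * x := by rw [hζ, one_mul]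
  have hy : (ζ ^ 2) ^ 3 * y = y := by
    calc (ζ ^ 2) ^ 3 * y = (ζ ^ 3) ^ 2 * y := by ring
      _ = y := by rw [hζ, one_pow, one_mul]
  have h'' : (W.baseChange (AlgebraicClosure k)).toAffine.Nonsingular (ζ * x) y := by
    rw [hx, hy] at h'; exact h'
  exact ⟨h'', e.trans (Affine.Point.some_eq_some_of_eq hx hy)⟩

variable {W W'}

/-- `(g v / v)³ = 1` when `(g v)³ = v³ ≠ 0`: the values of the cubic character
`χ(g) = v^{g-1} = g(v)/v` are cube roots of unity. [cite: HuShuYin2019, §1 p. 4] -/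
theorem div_pow_three_eq_one {v w : AlgebraicClosure k} (hv : v ≠ 0) (hw : w ^ 3 = v ^ 3) :
    (w / v) ^ 3 = 1 := by
  rw [div_pow, hw, div_self (pow_ne_zero 3 hv)]

/-- For `v³ = c ∈ k` every `g ∈ Γ_k` satisfies `(g v)³ = v³` — so `χ(g) = g(v)/v` is a cube root of
unity (Hu–Shu–Yin: `χ(σ) = (∛(3p))^{σ−1} ∈ 𝒪_K^×`). [cite: HuShuYin2019, §1 p. 4 (χ(σ) = (∛(3p))^{σ−1})] -/
theorem pow_three_smul_eq {c : k} {v : AlgebraicClosure k}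
    (hvc : v ^ 3 = algebraMap k (AlgebraicClosure k) c) (g : Field.absoluteGaloisGroup k) :
    ((show AlgebraicClosure k ≃ₐ[k] AlgebraicClosure k from g) v) ^ 3 = v ^ 3 := by
  rw [← map_pow, hvc, AlgEquiv.commutes]

/-- **The family `ρ_g = [ζ_g²]`, `ζ_g = g(v)/v`** (`g ∈ Γ_k`), for `v` with `(g v)³ = v³ ≠ 0` for all
`g`: additive automorphisms of `E(k̄)` with `ρ_g (x, y) = ((g v / v)² x, y)`.
[cite: HuShuYin2019, §1 p. 4] [cite: SilvermanAEC2009, Thm. III.10.1, X.2.2] -/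
theorem exists_rho (ha₁ : W.a₁ = 0) (ha₂ : W.a₂ = 0) (ha₃ : W.a₃ = 0) (ha₄ : W.a₄ = 0)
    {v : AlgebraicClosure k} (hv : v ≠ 0)
    (hv3 : ∀ g : Field.absoluteGaloisGroup k,
      ((show AlgebraicClosure k ≃ₐ[k] AlgebraicClosure k from g) v) ^ 3 = v ^ 3) :
    ∃ ρ : Field.absoluteGaloisGroup k → geomPoints W ≃+ geomPoints W,
      ∀ (g : Field.absoluteGaloisGroup k) {x y : AlgebraicClosure k}
        (h : (W.baseChange (AlgebraicClosure k)).toAffine.Nonsingular x y),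
        ∃ h', ρ g (Affine.Point.some x y h) =
          Affine.Point.some (((show AlgebraicClosure k ≃ₐ[k] AlgebraicClosure k from g) v / v) ^ 2 * x)
            y h' := by
  have hζ : ∀ g : Field.absoluteGaloisGroup k,
      (((show AlgebraicClosure k ≃ₐ[k] AlgebraicClosure k from g) v / v) ^ 2) ^ 3 = 1 := by
    intro g
    rw [← pow_mul, mul_comm, pow_mul, div_pow_three_eq_one hv (hv3 g), one_pow]
  exact ⟨fun g ↦ Classical.choose (exists_mulX_addEquiv W ha₁ ha₂ ha₃ ha₄ (hζ g)),
    fun g ↦ Classical.choose_spec (exists_mulX_addEquiv W ha₁ ha₂ ha₃ ha₄ (hζ g))⟩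

/-- **THE TWIST LAW** `g (ψ P) = ψ (ρ_g (g P))`: the transport `ψ : (x, y) ↦ (v²x, v³y)` intertwines
the `χ`-twisted `Γ_k`-action on `E(k̄)` (`χ(g) = g(v)/v`, `ρ_g = [χ(g)²]`) with the ordinary action
on `E'(k̄)` — coordinatewise `((gv)² gx, (gv)³ gy) = (v² (gv/v)² gx, v³ gy)`. This is the
`1`-cocycle `g ↦ ψ^g ψ⁻¹ ∈ Aut(E)` of the twist (Silverman X.2.2) made explicit for the cubic twist.
Stated on the coordinate descriptions of `ψ` and `ρ`. [cite: SilvermanAEC2009, X.2.2, X.5.4]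
[cite: HuShuYin2019, §2 p. 8] -/
theorem smul_cubicTwist_of_apply_eq {v : AlgebraicClosure k} (hv : v ≠ 0)
    {ψ : geomPoints W ≃+ geomPoints W'}
    (hψ : ∀ {x y : AlgebraicClosure k} (h : (W.baseChange (AlgebraicClosure k)).toAffine.Nonsingular x y),
        ∃ h', ψ (Affine.Point.some x y h) = Affine.Point.some (v ^ 2 * x) (v ^ 3 * y) h')
    {ρ : Field.absoluteGaloisGroup k → geomPoints W ≃+ geomPoints W}
    (hρ : ∀ (g : Field.absoluteGaloisGroup k) {x y : AlgebraicClosure k}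
        (h : (W.baseChange (AlgebraicClosure k)).toAffine.Nonsingular x y),
        ∃ h', ρ g (Affine.Point.some x y h) =
          Affine.Point.some (((show AlgebraicClosure k ≃ₐ[k] AlgebraicClosure k from g) v / v) ^ 2 * x)
            y h')
    (g : Field.absoluteGaloisGroup k)
    (hv3 : ((show AlgebraicClosure k ≃ₐ[k] AlgebraicClosure k from g) v) ^ 3 = v ^ 3)
    (P : geomPoints W) : g • ψ P = ψ (ρ g (g • P)) := by
  change (W.baseChange (AlgebraicClosure k)).toAffine.Point at P
  rcases P with _ | ⟨x, y, h⟩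
  · change g • ψ 0 = ψ (ρ g (g • (0 : geomPoints W)))
    rw [smul_zero, map_zero, map_zero, smul_zero, map_zero]
  · obtain ⟨h₁, e₁⟩ := hψ h
    obtain ⟨h₂, e₂⟩ := smul_some_eq W' g h₁
    obtain ⟨h₃, e₃⟩ := smul_some_eq W g h
    obtain ⟨h₄, e₄⟩ := hρ g h₃
    obtain ⟨h₅, e₅⟩ := hψ h₄
    refine ((congrArg (g • ·) e₁).trans e₂).trans
      (Eq.symm (((congrArg (fun Q ↦ ψ (ρ g Q)) e₃).trans ((congrArg ψ e₄).trans e₅)).trans ?_))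
    set σ := (show AlgebraicClosure k ≃ₐ[k] AlgebraicClosure k from g) with hσ
    refine Affine.Point.some_eq_some_of_eq ?_ ?_
    · rw [map_mul, map_pow]
      field_simp
    · rw [map_mul, map_pow, hv3]

/-- `ρ_g = 1` on `E(k̄)` when `g v = v` (then `χ(g) = 1`). [cite: SilvermanAEC2009, X.2.2] -/
theorem rho_apply_of_apply_eq {v : AlgebraicClosure k} (hv : v ≠ 0)
    {ρ : Field.absoluteGaloisGroup k → geomPoints W ≃+ geomPoints W}
    (hρ : ∀ (g : Field.absoluteGaloisGroup k) {x y : AlgebraicClosure k}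
        (h : (W.baseChange (AlgebraicClosure k)).toAffine.Nonsingular x y),
        ∃ h', ρ g (Affine.Point.some x y h) =
          Affine.Point.some (((show AlgebraicClosure k ≃ₐ[k] AlgebraicClosure k from g) v / v) ^ 2 * x)
            y h')
    {g : Field.absoluteGaloisGroup k}
    (hg : (show AlgebraicClosure k ≃ₐ[k] AlgebraicClosure k from g) v = v) (P : geomPoints W) :
    ρ g P = P := by
  change (W.baseChange (AlgebraicClosure k)).toAffine.Point at P
  rcases P with _ | ⟨x, y, h⟩
  · exact map_zero (ρ g)
  · obtain ⟨h₁, e₁⟩ := hρ g h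
    exact e₁.trans (Affine.Point.some_eq_some_of_eq (by rw [hg, div_self hv, one_pow, one_mul]) rfl)

/-- **`ψ` is `Gal(k̄/k(v))`-equivariant**: `ψ (g P) = g (ψ P)` whenever `g v = v` (Hu–Shu–Yin:
the isomorphism is "defined over `L_{(p)}`"). [cite: HuShuYin2019, §2 p. 8] -/
theorem cubicTwist_smul_of_fix {v : AlgebraicClosure k}
    {ψ : geomPoints W ≃+ geomPoints W'}
    (hψ : ∀ {x y : AlgebraicClosure k} (h : (W.baseChange (AlgebraicClosure k)).toAffine.Nonsingular x y),
        ∃ h', ψ (Affine.Point.some x y h) = Affine.Point.some (v ^ 2 * x) (v ^ 3 * y) h')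
    {g : Field.absoluteGaloisGroup k}
    (hg : (show AlgebraicClosure k ≃ₐ[k] AlgebraicClosure k from g) v = v) (P : geomPoints W) :
    ψ (g • P) = g • ψ P := by
  change (W.baseChange (AlgebraicClosure k)).toAffine.Point at P
  rcases P with _ | ⟨x, y, h⟩
  · change ψ (g • (0 : geomPoints W)) = g • ψ 0
    rw [smul_zero, map_zero, smul_zero]
  · obtain ⟨h₁, e₁⟩ := smul_some_eq W g h
    obtain ⟨h₂, e₂⟩ := hψ h
    obtain ⟨h₃, e₃⟩ := hψ h₁
    obtain ⟨h₄, e₄⟩ := smul_some_eq W' g h₂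
    refine ((congrArg ψ e₁).trans e₃).trans (Eq.symm (((congrArg (g • ·) e₂).trans e₄).trans ?_))
    exact Affine.Point.some_eq_some_of_eq (by rw [map_mul, map_pow, hg]) (by rw [map_mul, map_pow, hg])

/-- The inverse form of the twist law: `ψ⁻¹ (g P') = ρ_g (g (ψ⁻¹ P'))`. [cite: SilvermanAEC2009, X.2.2] -/
theorem cubicTwist_symm_smul {ψ : geomPoints W ≃+ geomPoints W'}
    {ρ : Field.absoluteGaloisGroup k → geomPoints W ≃+ geomPoints W}
    {g : Field.absoluteGaloisGroup k} (hlaw : ∀ P : geomPoints W, g • ψ P = ψ (ρ g (g • P)))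
    (P' : geomPoints W') : ψ.symm (g • P') = ρ g (g • ψ.symm P') := by
  apply ψ.injective
  rw [AddEquiv.apply_symm_apply, ← hlaw, AddEquiv.apply_symm_apply]

/-- **All cube roots of unity of `k̄` are fixed by `Γ_k` once `k` contains a primitive one**
(`ω ∈ k` with `ω² + ω + 1 = 0`, e.g. Hu–Shu–Yin's `K = ℚ(√−3) ∋ ω`): `z³ = 1 ⇒ z ∈ {1, ω, ω²} ⊆ k`
(`z³ − 1 = (z − 1)(z − ω)(z − ω²)`). [cite: HuShuYin2019, §1 p. 4 (K = ℚ(√−3), 𝒪_K = ℤ[ω])] -/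
theorem apply_eq_self_of_pow_three_eq_one {ω : k} (hω : ω ^ 2 + ω + 1 = 0)
    (g : AlgebraicClosure k ≃ₐ[k] AlgebraicClosure k) {z : AlgebraicClosure k} (hz : z ^ 3 = 1) :
    g z = z := by
  set ω' := algebraMap k (AlgebraicClosure k) ω with hω'
  have hω'2 : ω' ^ 2 + ω' + 1 = 0 := by
    rw [hω', ← map_pow, ← map_add, ← map_one (algebraMap k (AlgebraicClosure k)), ← map_add, hω,
      map_zero]
  have hfac : (z - 1) * (z - ω') * (z - ω' ^ 2) = 0 := by
    have : (z - 1) * (z - ω') * (z - ω' ^ 2) =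
        z ^ 3 - 1 - (ω' ^ 2 + ω' + 1) * z ^ 2 + (ω' ^ 2 + ω' + 1) * ω' * z
          - (ω' ^ 2 + ω' + 1) * (ω' - 1) := by ring
    rw [this, hω'2, hz]; ring
  rcases mul_eq_zero.mp hfac with h12 | h3
  · rcases mul_eq_zero.mp h12 with h1 | h2
    · rw [sub_eq_zero.mp h1, map_one]
    · rw [sub_eq_zero.mp h2, hω', AlgEquiv.commutes]
  · rw [sub_eq_zero.mp h3, map_pow, hω', AlgEquiv.commutes]

/-- **The `ρ_g` are `Γ_k`-equivariant when `μ₃ ⊂ k`**: `h (ρ_g P) = ρ_g (h P)` for all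
`g, h ∈ Γ_k` (coordinatewise `(ζ_g² hx, hy)` both ways, `h ζ_g = ζ_g`). [cite: SilvermanAEC2009, Thm. III.10.1] -/
theorem smul_rho_of_apply_eq {v : AlgebraicClosure k}
    {ρ : Field.absoluteGaloisGroup k → geomPoints W ≃+ geomPoints W}
    (hρ : ∀ (g : Field.absoluteGaloisGroup k) {x y : AlgebraicClosure k}
        (h : (W.baseChange (AlgebraicClosure k)).toAffine.Nonsingular x y),
        ∃ h', ρ g (Affine.Point.some x y h) =
          Affine.Point.some (((show AlgebraicClosure k ≃ₐ[k] AlgebraicClosure k from g) v / v) ^ 2 * x)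
            y h')
    (g h : Field.absoluteGaloisGroup k)
    (hfix : (show AlgebraicClosure k ≃ₐ[k] AlgebraicClosure k from h)
        ((show AlgebraicClosure k ≃ₐ[k] AlgebraicClosure k from g) v / v) =
      (show AlgebraicClosure k ≃ₐ[k] AlgebraicClosure k from g) v / v)
    (P : geomPoints W) : h • ρ g P = ρ g (h • P) := by
  change (W.baseChange (AlgebraicClosure k)).toAffine.Point at P
  rcases P with _ | ⟨x, y, hP⟩
  · change h • ρ g 0 = ρ g (h • (0 : geomPoints W))
    rw [map_zero, smul_zero, map_zero]
  · obtain ⟨h₁, e₁⟩ := hρ g hP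
    obtain ⟨h₂, e₂⟩ := smul_some_eq W h h₁
    obtain ⟨h₃, e₃⟩ := smul_some_eq W h hP
    obtain ⟨h₄, e₄⟩ := hρ g h₃
    refine ((congrArg (h • ·) e₁).trans e₂).trans (Eq.symm (((congrArg (ρ g) e₃).trans e₄).trans ?_))
    exact Affine.Point.some_eq_some_of_eq (by rw [map_mul, map_pow, hfix]) rfl

/-- **Fixed points correspond along `ψ` under any set `N ⊆ Γ_k` fixing `v`** (printed:
`N = Gal(k̄/H)` for a field `H ∋ ∛c`, e.g. Hu–Shu–Yin's `H_{9p} ⊇ L_{(3,p)} = K(∛3, ∛p)`):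
`(∀ h ∈ N, h (ψ Q) = ψ Q) ↔ (∀ h ∈ N, h Q = Q)`, i.e. `ψ` restricts to `E(H) ≃ E'(H)`.
[cite: HuShuYin2019, §2 p. 8] -/
theorem forall_smul_cubicTwist_eq_iff {v : AlgebraicClosure k}
    {ψ : geomPoints W ≃+ geomPoints W'}
    (hψ : ∀ {x y : AlgebraicClosure k} (h : (W.baseChange (AlgebraicClosure k)).toAffine.Nonsingular x y),
        ∃ h', ψ (Affine.Point.some x y h) = Affine.Point.some (v ^ 2 * x) (v ^ 3 * y) h')
    {N : Set (Field.absoluteGaloisGroup k)}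
    (hN : ∀ h ∈ N, (show AlgebraicClosure k ≃ₐ[k] AlgebraicClosure k from h) v = v)
    (Q : geomPoints W) : (∀ h ∈ N, h • ψ Q = ψ Q) ↔ ∀ h ∈ N, h • Q = Q := by
  refine ⟨fun H h hh ↦ ?_, fun H h hh ↦ ?_⟩
  · apply ψ.injective
    rw [cubicTwist_smul_of_fix hψ (hN h hh), H h hh]
  · rw [← cubicTwist_smul_of_fix hψ (hN h hh), H h hh]

/-- **The transport, bundled** (`ψ`, `ρ` and the twist law at once), for `v³ = c ∈ kˣ`,
`E' : y² = x³ + c² b`. [cite: HuShuYin2019, §2 p. 8] [cite: SilvermanAEC2009, X.2.2, X.5.4] -/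
theorem exists_cubicTwist_transport (ha₁ : W.a₁ = 0) (ha₂ : W.a₂ = 0) (ha₃ : W.a₃ = 0)
    (ha₄ : W.a₄ = 0) (ha₁' : W'.a₁ = 0) (ha₂' : W'.a₂ = 0) (ha₃' : W'.a₃ = 0) (ha₄' : W'.a₄ = 0)
    {c : k} (hc : c ≠ 0) (hW' : W'.a₆ = c ^ 2 * W.a₆) {v : AlgebraicClosure k}
    (hvc : v ^ 3 = algebraMap k (AlgebraicClosure k) c) :
    ∃ (ψ : geomPoints W ≃+ geomPoints W')
      (ρ : Field.absoluteGaloisGroup k → geomPoints W ≃+ geomPoints W),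
      (∀ {x y : AlgebraicClosure k} (h : (W.baseChange (AlgebraicClosure k)).toAffine.Nonsingular x y),
        ∃ h', ψ (Affine.Point.some x y h) = Affine.Point.some (v ^ 2 * x) (v ^ 3 * y) h') ∧
      (∀ (g : Field.absoluteGaloisGroup k) {x y : AlgebraicClosure k}
        (h : (W.baseChange (AlgebraicClosure k)).toAffine.Nonsingular x y),
        ∃ h', ρ g (Affine.Point.some x y h) =
          Affine.Point.some (((show AlgebraicClosure k ≃ₐ[k] AlgebraicClosure k from g) v / v) ^ 2 * x)
            y h') ∧
      ∀ (g : Field.absoluteGaloisGroup k) (P : geomPoints W), g • ψ P = ψ (ρ g (g • P)) := by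
  have hv : v ≠ 0 := by
    rintro rfl
    rw [zero_pow three_ne_zero, eq_comm, map_eq_zero] at hvc
    exact hc hvc
  obtain ⟨ψ, hψ⟩ := exists_cubicTwist_addEquiv W W' ha₁ ha₂ ha₃ ha₄ ha₁' ha₂' ha₃' ha₄' hc hW' hvc
  obtain ⟨ρ, hρ⟩ := exists_rho ha₁ ha₂ ha₃ ha₄ hv (pow_three_smul_eq hvc)
  exact ⟨ψ, ρ, hψ, hρ, fun g P ↦ smul_cubicTwist_of_apply_eq hv hψ hρ g (pow_three_smul_eq hvc g) P⟩

/-- **`μ₃ ⊂ k` ⇒ every `ρ_g` commutes with every `h ∈ Γ_k`** (combines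
`smul_rho_of_apply_eq` with `apply_eq_self_of_pow_three_eq_one`; the case `k = K ∋ ω` of
Hu–Shu–Yin). [cite: HuShuYin2019, §1 p. 4] -/
theorem smul_rho_of_omega {ω : k} (hω : ω ^ 2 + ω + 1 = 0) {v : AlgebraicClosure k} (hv : v ≠ 0)
    (hv3 : ∀ g : Field.absoluteGaloisGroup k,
      ((show AlgebraicClosure k ≃ₐ[k] AlgebraicClosure k from g) v) ^ 3 = v ^ 3)
    {ρ : Field.absoluteGaloisGroup k → geomPoints W ≃+ geomPoints W}
    (hρ : ∀ (g : Field.absoluteGaloisGroup k) {x y : AlgebraicClosure k}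
        (h : (W.baseChange (AlgebraicClosure k)).toAffine.Nonsingular x y),
        ∃ h', ρ g (Affine.Point.some x y h) =
          Affine.Point.some (((show AlgebraicClosure k ≃ₐ[k] AlgebraicClosure k from g) v / v) ^ 2 * x)
            y h')
    (g h : Field.absoluteGaloisGroup k) (P : geomPoints W) : h • ρ g P = ρ g (h • P) :=
  smul_rho_of_apply_eq hρ g h
    (apply_eq_self_of_pow_three_eq_one hω _ (div_pow_three_eq_one hv (hv3 g))) P

end Transport

/-! ## §3 The Kolyvagin dictionary along `ψ` -/

section Kolyvagin

open KolyvaginCocycle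

variable {k : Type u} [Field k] {W W' : WeierstrassCurve k}

/-- **Admissibility moves along `ψ`.** If `A ≤ E(k̄)` is `Γ_k`-stable with `[n]` injective
(`IsAdmissible`, printed `A = E(H)`) and stable under the `ρ_g` (automatic for `A = E(k̄)^{Γ_H}` when
`μ₃ ⊂ k`, by `smul_rho_of_omega`), then `ψ(A) ≤ E'(k̄)` (printed `E'(H)`, `H ∋ ∛c`) is admissible:
`g ψ(a) = ψ(ρ_g(g a))`. [cite: GrossLMS1991, §4 Lemma 4.3] [cite: SilvermanAEC2009, X.2.2] -/
theorem isAdmissible_map_cubicTwist {ψ : geomPoints W ≃+ geomPoints W'}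
    {ρ : Field.absoluteGaloisGroup k → geomPoints W ≃+ geomPoints W}
    (hlaw : ∀ (g : Field.absoluteGaloisGroup k) (P : geomPoints W), g • ψ P = ψ (ρ g (g • P)))
    {A : AddSubgroup (geomPoints W)} {n : ℤ}
    (hA : IsAdmissible (Field.absoluteGaloisGroup k) A n)
    (hAρ : ∀ (g : Field.absoluteGaloisGroup k), ∀ a ∈ A, ρ g a ∈ A) :
    IsAdmissible (Field.absoluteGaloisGroup k) (A.map ψ.toAddMonoidHom) n where
  smul_mem := by
    rintro g _ ⟨a, ha, rfl⟩
    refine ⟨ρ g (g • a), hAρ g _ (hA.smul_mem g ha), ?_⟩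
    change ψ (ρ g (g • a)) = g • ψ a
    exact (hlaw g a).symm
  eq_zero_of_zsmul := by
    rintro _ ⟨a, ha, rfl⟩ hx
    change n • ψ a = 0 at hx
    rw [← map_zsmul] at hx
    have ha0 : a = 0 := hA.eq_zero_of_zsmul ha (ψ.injective (hx.trans (map_zero ψ).symm))
    change ψ a = 0
    rw [ha0, map_zero]

/-- Membership in `ψ(A)`: `ψ Q ∈ ψ(A) ↔ Q ∈ A`. [folklore] -/
private theorem cubicTwist_mem_map_iff (ψ : geomPoints W ≃+ geomPoints W') (A : AddSubgroup (geomPoints W))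
    (Q : geomPoints W) : ψ Q ∈ A.map ψ.toAddMonoidHom ↔ Q ∈ A := by
  constructor
  · rintro ⟨a, ha, e⟩
    rwa [← ψ.injective e]
  · exact fun hQ ↦ ⟨Q, hQ, rfl⟩

/-- **The `χ`-isotypic condition.** `ψ Q` has `Γ_k`-invariant class in `ψ(A)/nψ(A)` (the input
`invPoints` of McCallum's cocycle for `E'`) iff `Q ∈ A` and `ρ_g (g Q) − Q ∈ nA` for all `g` — the
condition *"`[P_n^χ] ∈ (E_9(H_{9pn})/2^M)^{(Gal(H_{9pn}/K), χ)} := {Q : hQ ≡ [χ(h)] Q}`"* of the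
memo / Gross §12 (`y_χ`), up to the unit `[χ(h)]` (`A` being `𝒪`-stable).
[cite: GrossLMS1991, §4 (4.1), §12 p. 232] [cite: McCallumLMS1991, §4 (4)] -/
theorem cubicTwist_mem_invPoints_iff {ψ : geomPoints W ≃+ geomPoints W'}
    {ρ : Field.absoluteGaloisGroup k → geomPoints W ≃+ geomPoints W}
    (hlaw : ∀ (g : Field.absoluteGaloisGroup k) (P : geomPoints W), g • ψ P = ψ (ρ g (g • P)))
    (A : AddSubgroup (geomPoints W)) (n : ℤ) (Q : geomPoints W) :
    ψ Q ∈ invPoints (Field.absoluteGaloisGroup k) (A.map ψ.toAddMonoidHom) n ↔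
      Q ∈ A ∧ ∀ g : Field.absoluteGaloisGroup k, ∃ R ∈ A, n • R = ρ g (g • Q) - Q := by
  rw [mem_invPoints_iff, cubicTwist_mem_map_iff]
  refine and_congr_right fun _ ↦ forall_congr' fun g ↦ ?_
  constructor
  · rintro ⟨_, ⟨R, hR, rfl⟩, e⟩
    refine ⟨R, hR, ψ.injective ?_⟩
    change n • ψ R = g • ψ Q - ψ Q at e
    rw [map_zsmul, e, hlaw, ← map_sub]
  · rintro ⟨R, hR, e⟩
    refine ⟨ψ R, ⟨R, hR, rfl⟩, ?_⟩
    rw [← map_zsmul, e, hlaw, map_sub]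

/-- **Gross's Prop. 4.7 (1) in the twisted frame**: for `A ⊇ E(k̄)^N` (`N ⊆ Γ_k` fixing `v` and `Q`;
printed `N = Gal(k̄/H_{9pn})`, `A = E_9(H_{9pn})`), Kolyvagin's class of `ψ Q ∈ E'(k̄)` relative to
`ψ(A)` vanishes iff `Q ∈ nA`: *"`c(n) = 0 ⟺ P_n^χ ∈ 2^M E_9(H_{9pn})`"* (memo §57.4, from
[G91 Prop. 4.7]). [cite: GrossLMS1991, Prop. 4.7 (1)] [cite: McCallumLMS1991, Cor. 4.5] -/
theorem kolyvaginClass_cubicTwist_eq_zero_iff {v : AlgebraicClosure k}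
    {ψ : geomPoints W ≃+ geomPoints W'}
    (hψ : ∀ {x y : AlgebraicClosure k} (h : (W.baseChange (AlgebraicClosure k)).toAffine.Nonsingular x y),
        ∃ h', ψ (Affine.Point.some x y h) = Affine.Point.some (v ^ 2 * x) (v ^ 3 * y) h')
    {N : Set (Field.absoluteGaloisGroup k)}
    (hN : ∀ h ∈ N, (show AlgebraicClosure k ≃ₐ[k] AlgebraicClosure k from h) v = v)
    {A : AddSubgroup (geomPoints W)} (hAN : ∀ P : geomPoints W, (∀ h ∈ N, h • P = P) → P ∈ A)
    {Q : geomPoints W} (hNQ : ∀ h ∈ N, h • Q = Q) {n : ℤ}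
    {hdiv : ∀ P : geomPoints W', ∃ R : geomPoints W', n • R = P}
    (hA' : IsAdmissible (Field.absoluteGaloisGroup k) (A.map ψ.toAddMonoidHom) n)
    (hQ' : ψ Q ∈ invPoints (Field.absoluteGaloisGroup k) (A.map ψ.toAddMonoidHom) n) :
    kolyvaginClass W' n hdiv hA' (ψ Q) hQ' = 0 ↔ ∃ B ∈ A, n • B = Q := by
  have hNP : ∀ h ∈ N, h • ψ Q = ψ Q := (forall_smul_cubicTwist_eq_iff hψ hN Q).mpr hNQ
  have hAN' : ∀ P' : geomPoints W', (∀ h ∈ N, h • P' = P') → P' ∈ A.map ψ.toAddMonoidHom := by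
    intro P' hP'
    refine ⟨ψ.symm P', hAN _ ((forall_smul_cubicTwist_eq_iff hψ hN (ψ.symm P')).mp ?_), ?_⟩
    · simpa only [AddEquiv.apply_symm_apply] using hP'
    · exact ψ.apply_symm_apply P'
  rw [kolyvaginClass_eq_zero_iff hA' hQ' hNP hAN']
  constructor
  · rintro ⟨_, ⟨B, hB, rfl⟩, e⟩
    refine ⟨B, hB, ψ.injective ?_⟩
    rw [map_zsmul]
    exact e
  · rintro ⟨B, hB, e⟩
    refine ⟨ψ B, ⟨B, hB, rfl⟩, ?_⟩
    rw [← map_zsmul, e]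

/-- **Gross's Prop. 4.7 (2) in the twisted frame** (over a perfect `k`): the image `d` of
Kolyvagin's class of `ψ Q` in `H¹(k, E')` vanishes iff `Q ∈ nA + E^χ(k)`, where
`E^χ(k) := {Q₀ ∈ E(k̄) : ρ_g (g Q₀) = Q₀ ∀ g}` are the `χ`-eigenpoints — the points of `E'(k)` seen on
`E` (`exists_toGeomPoints_eq_cubicTwist_iff`). [cite: GrossLMS1991, Prop. 4.7 (2)] -/
theorem torsionH1ToH1_kolyvaginClass_cubicTwist_eq_zero_iff [PerfectField k] {v : AlgebraicClosure k}
    {ψ : geomPoints W ≃+ geomPoints W'}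
    (hψ : ∀ {x y : AlgebraicClosure k} (h : (W.baseChange (AlgebraicClosure k)).toAffine.Nonsingular x y),
        ∃ h', ψ (Affine.Point.some x y h) = Affine.Point.some (v ^ 2 * x) (v ^ 3 * y) h')
    {ρ : Field.absoluteGaloisGroup k → geomPoints W ≃+ geomPoints W}
    (hlaw : ∀ (g : Field.absoluteGaloisGroup k) (P : geomPoints W), g • ψ P = ψ (ρ g (g • P)))
    {N : Set (Field.absoluteGaloisGroup k)}
    (hN : ∀ h ∈ N, (show AlgebraicClosure k ≃ₐ[k] AlgebraicClosure k from h) v = v)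
    {A : AddSubgroup (geomPoints W)} (hAN : ∀ P : geomPoints W, (∀ h ∈ N, h • P = P) → P ∈ A)
    {Q : geomPoints W} (hNQ : ∀ h ∈ N, h • Q = Q) {n : ℤ}
    {hdiv : ∀ P : geomPoints W', ∃ R : geomPoints W', n • R = P}
    (hA' : IsAdmissible (Field.absoluteGaloisGroup k) (A.map ψ.toAddMonoidHom) n)
    (hQ' : ψ Q ∈ invPoints (Field.absoluteGaloisGroup k) (A.map ψ.toAddMonoidHom) n) :
    torsionH1ToH1 W' n (kolyvaginClass W' n hdiv hA' (ψ Q) hQ') = 0 ↔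
      ∃ B ∈ A, ∃ Q₀ : geomPoints W,
        (∀ g : Field.absoluteGaloisGroup k, ρ g (g • Q₀) = Q₀) ∧ Q = n • B + Q₀ := by
  have hNP : ∀ h ∈ N, h • ψ Q = ψ Q := (forall_smul_cubicTwist_eq_iff hψ hN Q).mpr hNQ
  have hAN' : ∀ P' : geomPoints W', (∀ h ∈ N, h • P' = P') → P' ∈ A.map ψ.toAddMonoidHom := by
    intro P' hP'
    refine ⟨ψ.symm P', hAN _ ((forall_smul_cubicTwist_eq_iff hψ hN (ψ.symm P')).mp ?_), ?_⟩
    · simpa only [AddEquiv.apply_symm_apply] using hP'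
    · exact ψ.apply_symm_apply P'
  rw [torsionH1ToH1_kolyvaginClass_eq_zero_iff hA' hQ' hNP hAN']
  constructor
  · rintro ⟨_, ⟨B, hB, rfl⟩, P₀, e⟩
    refine ⟨B, hB, ψ.symm (toGeomPoints W' P₀), fun g ↦ ?_, ψ.injective ?_⟩
    · rw [← cubicTwist_symm_smul (hlaw g), smul_toGeomPoints]
    · rw [map_add, map_zsmul, AddEquiv.apply_symm_apply]
      exact e
  · rintro ⟨B, hB, Q₀, hQ₀, rfl⟩
    have hfix : ∀ g : Field.absoluteGaloisGroup k, g • ψ Q₀ = ψ Q₀ := fun g ↦ by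
      rw [hlaw g, hQ₀ g]
    obtain ⟨P₀, hP₀⟩ := exists_toGeomPoints_eq_of_forall_smul_eq W' hfix
    refine ⟨ψ B, ⟨B, hB, rfl⟩, P₀, ?_⟩
    rw [map_add, map_zsmul, hP₀]

/-- **Rationality dictionary** (perfect `k`): `ψ Q` comes from `E'(k)` iff `ρ_g (g Q) = Q` for all
`g ∈ Γ_k` — Hu–Shu–Yin's *"`E_1(L_{(p)})^{σ_{ω₃} = ω^α}` is identified with `E_p(K)` under the
isomorphism `(x, y) ↦ ((∛p)² x, p y)`"*. [cite: HuShuYin2019, §3 p. 8] -/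
theorem exists_toGeomPoints_eq_cubicTwist_iff [PerfectField k] {ψ : geomPoints W ≃+ geomPoints W'}
    {ρ : Field.absoluteGaloisGroup k → geomPoints W ≃+ geomPoints W}
    (hlaw : ∀ (g : Field.absoluteGaloisGroup k) (P : geomPoints W), g • ψ P = ψ (ρ g (g • P)))
    (Q : geomPoints W) :
    (∃ P₀ : W'.toAffine.Point, toGeomPoints W' P₀ = ψ Q) ↔
      ∀ g : Field.absoluteGaloisGroup k, ρ g (g • Q) = Q := by
  constructor
  · rintro ⟨P₀, hP₀⟩ g
    apply ψ.injective
    rw [← hlaw g, ← hP₀, smul_toGeomPoints]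
  · intro hQ
    exact exists_toGeomPoints_eq_of_forall_smul_eq W' fun g ↦ by rw [hlaw g, hQ g]

end Kolyvagin

/-! ## §4 The twist law for a lift `τ` of an automorphism of `K/k₀` -/

section Lift

variable {k₀ : Type v} {K : Type u} [Field k₀] [Field K] [Algebra k₀ K] (W W' : WeierstrassCurve k₀)
  {σ : K ≃ₐ[k₀] K} {τ : AlgebraicClosure K ≃+* AlgebraicClosure K}

/-- `IsLiftOfAut.pointsMap` is coordinatewise `τ` (definitionally). [folklore] -/
private theorem pointsMap_some_eq (hτ : IsLiftOfAut σ τ) {x y : AlgebraicClosure K}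
    (h : ((W.baseChange K).baseChange (AlgebraicClosure K)).toAffine.Nonsingular x y) :
    ∃ h', hτ.pointsMap W (Affine.Point.some x y h) = Affine.Point.some (τ x) (τ y) h' :=
  ⟨_, rfl⟩

/-- **The twist law for a lift `τ`** (of `σ ∈ Aut(K/k₀)` to `K̄`; printed: complex conjugation on
`E(K̄)` for `K = ℚ(ω)`, Gross 1991 §5): for curves `E, E'` defined over `k₀` and `v ∈ K̄` with
`(τ v)³ = v³ ≠ 0` (e.g. `v³ ∈ k₀`), `τ (ψ P) = ψ (ρ_τ (τ P))` with `ρ_τ = [(τ v / v)²]`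
(coordinatewise, as in `smul_cubicTwist_of_apply_eq`). With Gross's Prop. 5.4 this gives the
`τ`-behaviour of the twisted classes (memo §57.4 flag (h4)). [cite: GrossLMS1991, Prop. 5.4]
[cite: SilvermanAEC2009, X.2.2] -/
theorem IsLiftOfAut.pointsMap_cubicTwist_of_apply_eq (hτ : IsLiftOfAut σ τ) {v : AlgebraicClosure K}
    (hv : v ≠ 0) (hτv : (τ v) ^ 3 = v ^ 3)
    {ψ : geomPoints (W.baseChange K) ≃+ geomPoints (W'.baseChange K)}
    (hψ : ∀ {x y : AlgebraicClosure K}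
        (h : ((W.baseChange K).baseChange (AlgebraicClosure K)).toAffine.Nonsingular x y),
        ∃ h', ψ (Affine.Point.some x y h) = Affine.Point.some (v ^ 2 * x) (v ^ 3 * y) h')
    {ρτ : geomPoints (W.baseChange K) ≃+ geomPoints (W.baseChange K)}
    (hρτ : ∀ {x y : AlgebraicClosure K}
        (h : ((W.baseChange K).baseChange (AlgebraicClosure K)).toAffine.Nonsingular x y),
        ∃ h', ρτ (Affine.Point.some x y h) = Affine.Point.some ((τ v / v) ^ 2 * x) y h')
    (P : geomPoints (W.baseChange K)) :
    hτ.pointsMap W' (ψ P) = ψ (ρτ (hτ.pointsMap W P)) := by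
  change ((W.baseChange K).baseChange (AlgebraicClosure K)).toAffine.Point at P
  rcases P with _ | ⟨x, y, h⟩
  · change hτ.pointsMap W' (ψ 0) = ψ (ρτ (hτ.pointsMap W 0))
    rw [map_zero, map_zero, map_zero, map_zero, map_zero]
  · obtain ⟨h₁, e₁⟩ := hψ h
    obtain ⟨h₂, e₂⟩ := pointsMap_some_eq W' hτ h₁
    obtain ⟨h₃, e₃⟩ := pointsMap_some_eq W hτ h
    obtain ⟨h₄, e₄⟩ := hρτ h₃
    obtain ⟨h₅, e₅⟩ := hψ h₄
    refine ((congrArg (hτ.pointsMap W') e₁).trans e₂).trans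
      (Eq.symm (((congrArg (fun Q ↦ ψ (ρτ Q)) e₃).trans ((congrArg ψ e₄).trans e₅)).trans ?_))
    refine Affine.Point.some_eq_some_of_eq ?_ ?_
    · rw [map_mul, map_pow]
      field_simp
    · rw [map_mul, map_pow, hτv]

/-- Existence of `ρ_τ = [(τ v / v)²]` for the lift law (`((τ v / v)²)³ = 1`).
[cite: SilvermanAEC2009, Thm. III.10.1] -/
theorem IsLiftOfAut.exists_rho (ha₁ : W.a₁ = 0) (ha₂ : W.a₂ = 0) (ha₃ : W.a₃ = 0) (ha₄ : W.a₄ = 0)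
    {v : AlgebraicClosure K} (hv : v ≠ 0) (hτv : (τ v) ^ 3 = v ^ 3) :
    ∃ ρτ : geomPoints (W.baseChange K) ≃+ geomPoints (W.baseChange K),
      ∀ {x y : AlgebraicClosure K}
        (h : ((W.baseChange K).baseChange (AlgebraicClosure K)).toAffine.Nonsingular x y),
        ∃ h', ρτ (Affine.Point.some x y h) = Affine.Point.some ((τ v / v) ^ 2 * x) y h' := by
  have hζ : ((τ v / v) ^ 2) ^ 3 = 1 := by
    rw [← pow_mul, mul_comm, pow_mul, div_pow_three_eq_one hv hτv, one_pow]
  exact exists_mulX_addEquiv (W.baseChange K) (by simp [WeierstrassCurve.baseChange, ha₁])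
    (by simp [WeierstrassCurve.baseChange, ha₂]) (by simp [WeierstrassCurve.baseChange, ha₃])
    (by simp [WeierstrassCurve.baseChange, ha₄]) hζ

end Lift

end JZero

/-! ## §5 Hu–Shu–Yin's cube-sum models `E_a : y² = x³ − 432 a²` -/

namespace HuShuYin2019

/-- **The cubic twist `E_a ≅ E_{ac}` over `K(∛c)` with its Galois law**, for Hu–Shu–Yin's models
`cubeSumCurve n = ⟨0, 0, 0, 0, −432 n²⟩` based-changed to a field `K` of characteristic `0`
(printed `K = ℚ(√−3)`) and `v ∈ K̄` with `v³ = c ≠ 0`: `ψ : E_a(K̄) ≃+ E_{ac}(K̄)`,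
`(x, y) ↦ (v² x, v³ y)`; `ρ_g = [(g v / v)²]`; `g (ψ P) = ψ (ρ_g (g P))`. Instances: `(a, c) = (1, p)`
is Hu–Shu–Yin's `E_1 ≅ E_p`, `(x, y) ↦ ((∛p)²x, py)`; `(9, 1/9)` their `φ : E_9 → E_1`;
`(9, p/9)` and `(9, p²/3)` the cell's `E_9 ≅ E_p = B` and `E_9 ≅ E_{3p²} = A` (memo two §57.3/(h2),
`χ_B(g) = (∛(p/9))^{g−1} = (∛(3p))^{g−1}`, `χ_A = χ_B²`). [cite: HuShuYin2019, §2 p. 8, §1 p. 4] -/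
theorem exists_cubicTwist_transport_cubeSumCurve (K : Type u) [Field K] [CharZero K] (a c : ℚ)
    (hc : c ≠ 0) {v : AlgebraicClosure K} (hvc : v ^ 3 = algebraMap ℚ (AlgebraicClosure K) c) :
    ∃ (ψ : geomPoints ((cubeSumCurve a).baseChange K) ≃+ geomPoints ((cubeSumCurve (a * c)).baseChange K))
      (ρ : Field.absoluteGaloisGroup K →
        geomPoints ((cubeSumCurve a).baseChange K) ≃+ geomPoints ((cubeSumCurve a).baseChange K)),
      (∀ {x y : AlgebraicClosure K}
        (h : (((cubeSumCurve a).baseChange K).baseChange (AlgebraicClosure K)).toAffine.Nonsingular x y),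
        ∃ h', ψ (Affine.Point.some x y h) = Affine.Point.some (v ^ 2 * x) (v ^ 3 * y) h') ∧
      (∀ (g : Field.absoluteGaloisGroup K) {x y : AlgebraicClosure K}
        (h : (((cubeSumCurve a).baseChange K).baseChange (AlgebraicClosure K)).toAffine.Nonsingular x y),
        ∃ h', ρ g (Affine.Point.some x y h) =
          Affine.Point.some (((show AlgebraicClosure K ≃ₐ[K] AlgebraicClosure K from g) v / v) ^ 2 * x)
            y h') ∧
      ∀ (g : Field.absoluteGaloisGroup K) (P : geomPoints ((cubeSumCurve a).baseChange K)),
        g • ψ P = ψ (ρ g (g • P)) := by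
  have hcK : algebraMap ℚ K c ≠ 0 := by rwa [ne_eq, map_eq_zero]
  have hW' : ((cubeSumCurve (a * c)).baseChange K).a₆ =
      algebraMap ℚ K c ^ 2 * ((cubeSumCurve a).baseChange K).a₆ := by
    change algebraMap ℚ K (-432 * (a * c) ^ 2) = algebraMap ℚ K c ^ 2 * algebraMap ℚ K (-432 * a ^ 2)
    rw [← map_pow, ← map_mul]
    congr 1
    ring
  have hvc' : v ^ 3 = algebraMap K (AlgebraicClosure K) (algebraMap ℚ K c) := by
    rw [hvc, eq_ratCast (algebraMap ℚ K), map_ratCast, eq_ratCast]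
  exact JZero.exists_cubicTwist_transport
    (by change algebraMap ℚ K 0 = 0; exact map_zero _) (by change algebraMap ℚ K 0 = 0; exact map_zero _)
    (by change algebraMap ℚ K 0 = 0; exact map_zero _) (by change algebraMap ℚ K 0 = 0; exact map_zero _)
    (by change algebraMap ℚ K 0 = 0; exact map_zero _) (by change algebraMap ℚ K 0 = 0; exact map_zero _)
    (by change algebraMap ℚ K 0 = 0; exact map_zero _) (by change algebraMap ℚ K 0 = 0; exact map_zero _)
    hcK hW' hvc'

end HuShuYin2019

end Literature.NumberTheory.EllipticCurves
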